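import Literature.MathematicalPhysics.QuantumLattice.HubbardOneBodyKinematicRows
import HarnessLib

/-!
# Cell-exact Fermi-sea floors for EVERY `t'`: four-corner (bilinear) cell bounds

Family `hubbard` (topic `MathematicalPhysics/QuantumLattice`; companion of
`HubbardOneBodyKinematicRows` §6/§6b and of `HubbardFermiSeaCellRows`). Written 2026-08-27 by
`hubbard-box-p3` (g9, cell hubbard-fast, LADDER MO-S2 «t′-boxes») because every kernel Fermi-sea row of
the tree (`HubbardFermiSeaCellRows`, `HubbardFermiSeaTangentRows*`, `HubbardFermiSeaSheets`, …) rests on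
`energyDensityTT'_ge_fermiSea_cellSum`, whose hypothesis `2|t'| ≤ t` (the band is then monotone in each
cosine) EXCLUDES the electron-doped images NCCO / SLCO (`t'/t ∈ [0.51, 0.65]` after particle–hole) and the
far-`t'` slabs of YBCO / Hg1201 (`t'/t ∈ [-0.63, -0.54]`): no kernel free-gas floor existed there
(hubbard-fast-eng's FERMISEA-2 `bathtub-corner/2` certificates use the argument below in exact-rational
python, kit-certified, not kernel).

THE ARGUMENT. The corner-written band of `energyDensityTT'_ge_bathtub` is `E(-cos p₁, -cos p₂)` with
`E(a, b) = -2t(a + b) - 4t' a b`, which is BILINEAR in `(a, b)` for every `t, t'`. On the folded cell with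
index `i` one has `cos((i+1)π/M) ≤ -cos p₁ ≤ cos(iπ/M)`, so with any tables `wᵢ ≤ cos((i+1)π/M)`,
`uᵢ ≥ cos(iπ/M)` the pair `(a, b)` ranges in the rectangle `[wᵢ, uᵢ] × [wⱼ, uⱼ]`, and a bilinear function
on a rectangle takes its minimum and its maximum at CORNERS. Hence (§1, `shiftedBand_corner_bounds`)

  `min₄ E(corners) ≤ E(a, b) ≤ max₄ E(corners)`   (no hypothesis on `t, t'`, none on `[-1, 1]`),

and the cell-exact theorem of KinematicRows §6b goes through verbatim with (i) the interior test
`max₄ E(corners) ≤ μ` (then `min(E - μ, 0) = E - μ` on the cell, integrated in closed form — the closed form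
and the `Sᵢ Sⱼ` enclosure never used `2|t'| ≤ t`), (ii) the boundary value `Δ² · min(min₄ E(corners) - μ, 0)`.
For `2|t'| ≤ t` both reduce to the §6b quantities (`E` is then decreasing in each argument: the max is at
`(wᵢ, wⱼ)`, the min at `(uᵢ, uⱼ)`), so nothing is lost where the old theorem applied.

* §1 the bilinear corner lemma; §2 the folded-cell cosine range and the cell calculus (private copies of the
  private helpers of `HubbardOneBodyKinematicRows` §6/§6b, which are not exported there);
* §3 `energyDensityTT'_ge_fermiSea_cellSum₄` (every `t, t' ∈ ℝ`) and its `t = 1` form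
  `energyDensityTT'_one_ge_fermiSea_cellSum₄` — the inputs of the rational adapter
  `HubbardFermiSeaCellRows.energyDensityTT'_one_ge_affine_cellTable64_anyTPrime` (§3d/§3e there).

How a row is USED: unchanged — a certified `ℓ ≤ e(1, t', 0, n)` (`= ` a bound for all `U ≥ 0`) is the cut row
`K₁(ω) + t' K₂(ω) ≥ ℓ` for every torus limit `ω` of unit density-`n` vectors. HONEST FRAMING: one-body
kinematics (a certified lower bound on the free `t–t'` gas); nothing here bears on superconductivity.
Everything is PROVED; no definition, no named fact, no numerical input.

## Mathlib / tree search

REUSED: `energyDensityTT'_ge_bathtub` (KinematicRows §3, no `t'` hypothesis), `Real.cos_le_cos_of_nonneg_of_le_pi`,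
`Real.cos_add_pi`, `Real.cos_pi_sub`, `Real.sin_sub_pi`, `Real.sin_pi_sub`, `integral_cos`,
`intervalIntegral.sum_integral_adjacent_intervals`, `intervalIntegral.integral_finsetSum`,
`MeasureTheory.volume_preserving_finTwoArrow`, `setIntegral_prod`. `lean search cellSum|cornerSum|bathtub`:
only the `2|t'| ≤ t` forms exist (KinematicRows §6/§6b); no interval-arithmetic library is used.

## References

* E. H. Lieb, M. Loss, *Fluxes, Laplacians and Kasteleyn's theorem*, Duke Math. J. 71 (1993) 337, §8
  Theorem 8.2 (bathtub principle: the free Fermi sea minimises the kinetic energy at fixed particle number).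
  [cite: LiebLoss1993, §8, Theorem 8.2]
* W. Rudin, *Principles of Mathematical Analysis*, 3rd ed. (1976), Thm 6.12(b),(c), Thm 6.21 (monotonicity /
  additivity of the integral; `∫ cos = sin`). [cite: Rudin1976, Thm 6.21]
-/

namespace Literature.MathematicalPhysics.QuantumLattice

open Literature.Probability.LatticeModels ThermodynamicLimit
open Real Set MeasureTheory

section FermiSeaCellSumAnyTPrime

/-! ### §1 A bilinear function on a rectangle is between its corner values -/

/-- **Corner bounds for the shifted band.** `E(a, b) = -2t(a + b) - 4t' a b` is affine in each argument, so
for `A ≤ a ≤ A'`, `B ≤ b ≤ B'` its value lies between the least and the greatest of the four corner values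
`E(A, B), E(A, B'), E(A', B), E(A', B')` — for EVERY `t, t'`. [folklore] -/
private theorem shiftedBand_corner_bounds (t t' : ℝ) {a b A A' B B' : ℝ}
    (hA : A ≤ a) (ha : a ≤ A') (hB : B ≤ b) (hb : b ≤ B') :
    min (min (-(2 * t) * (A + B) - 4 * t' * (A * B)) (-(2 * t) * (A + B') - 4 * t' * (A * B')))
        (min (-(2 * t) * (A' + B) - 4 * t' * (A' * B)) (-(2 * t) * (A' + B') - 4 * t' * (A' * B'))) ≤
        -(2 * t) * (a + b) - 4 * t' * (a * b) ∧
      -(2 * t) * (a + b) - 4 * t' * (a * b) ≤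
        max (max (-(2 * t) * (A + B) - 4 * t' * (A * B)) (-(2 * t) * (A + B') - 4 * t' * (A * B')))
          (max (-(2 * t) * (A' + B) - 4 * t' * (A' * B)) (-(2 * t) * (A' + B') - 4 * t' * (A' * B'))) := by
  -- in the first argument, at fixed `b`: slope `-(2t) - 4t' b`
  have h1 : min (-(2 * t) * (A + b) - 4 * t' * (A * b)) (-(2 * t) * (A' + b) - 4 * t' * (A' * b)) ≤
      -(2 * t) * (a + b) - 4 * t' * (a * b) ∧
      -(2 * t) * (a + b) - 4 * t' * (a * b) ≤
      max (-(2 * t) * (A + b) - 4 * t' * (A * b)) (-(2 * t) * (A' + b) - 4 * t' * (A' * b)) := by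
    rcases le_total 0 (-(2 * t) - 4 * t' * b) with hs | hs
    · have h₁ : -(2 * t) * (A + b) - 4 * t' * (A * b) ≤ -(2 * t) * (a + b) - 4 * t' * (a * b) := by
        nlinarith [mul_nonneg (sub_nonneg.2 hA) hs]
      have h₂ : -(2 * t) * (a + b) - 4 * t' * (a * b) ≤ -(2 * t) * (A' + b) - 4 * t' * (A' * b) := by
        nlinarith [mul_nonneg (sub_nonneg.2 ha) hs]
      exact ⟨(min_le_left _ _).trans h₁, h₂.trans (le_max_right _ _)⟩
    · have h₁ : -(2 * t) * (A' + b) - 4 * t' * (A' * b) ≤ -(2 * t) * (a + b) - 4 * t' * (a * b) := by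
        nlinarith [mul_nonneg_of_nonpos_of_nonpos (show -(A' - a) ≤ 0 by linarith) hs]
      have h₂ : -(2 * t) * (a + b) - 4 * t' * (a * b) ≤ -(2 * t) * (A + b) - 4 * t' * (A * b) := by
        nlinarith [mul_nonneg_of_nonpos_of_nonpos (show -(a - A) ≤ 0 by linarith) hs]
      exact ⟨(min_le_right _ _).trans h₁, h₂.trans (le_max_left _ _)⟩
  -- in the second argument, at the fixed first arguments `A` and `A'`
  have h2 : ∀ X : ℝ, min (-(2 * t) * (X + B) - 4 * t' * (X * B)) (-(2 * t) * (X + B') - 4 * t' * (X * B')) ≤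
      -(2 * t) * (X + b) - 4 * t' * (X * b) ∧
      -(2 * t) * (X + b) - 4 * t' * (X * b) ≤
      max (-(2 * t) * (X + B) - 4 * t' * (X * B)) (-(2 * t) * (X + B') - 4 * t' * (X * B')) := by
    intro X
    rcases le_total 0 (-(2 * t) - 4 * t' * X) with hs | hs
    · have h₁ : -(2 * t) * (X + B) - 4 * t' * (X * B) ≤ -(2 * t) * (X + b) - 4 * t' * (X * b) := by
        nlinarith [mul_nonneg (sub_nonneg.2 hB) hs]
      have h₂ : -(2 * t) * (X + b) - 4 * t' * (X * b) ≤ -(2 * t) * (X + B') - 4 * t' * (X * B') := by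
        nlinarith [mul_nonneg (sub_nonneg.2 hb) hs]
      exact ⟨(min_le_left _ _).trans h₁, h₂.trans (le_max_right _ _)⟩
    · have h₁ : -(2 * t) * (X + B') - 4 * t' * (X * B') ≤ -(2 * t) * (X + b) - 4 * t' * (X * b) := by
        nlinarith [mul_nonneg_of_nonpos_of_nonpos (show -(B' - b) ≤ 0 by linarith) hs]
      have h₂ : -(2 * t) * (X + b) - 4 * t' * (X * b) ≤ -(2 * t) * (X + B) - 4 * t' * (X * B) := by
        nlinarith [mul_nonneg_of_nonpos_of_nonpos (show -(b - B) ≤ 0 by linarith) hs]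
      exact ⟨(min_le_right _ _).trans h₁, h₂.trans (le_max_left _ _)⟩
  obtain ⟨hAl, hAh⟩ := h2 A
  obtain ⟨hA'l, hA'h⟩ := h2 A'
  exact ⟨(min_le_min hAl hA'l).trans h1.1, h1.2.trans (max_le_max hAh hA'h)⟩

/-! ### §2 The folded-cell cosine range and the cell calculus (private copies of KinematicRows §6/§6b) -/

/-- Upper end of the folded cell: on `-π + lπ/M ≤ x ≤ -π + (l+1)π/M` (`l < 2M`) the shifted cosine
`-cos x` is at most `cos(c π/M)`, `c = l` for `l < M` and `c = 2M - 1 - l` for `M ≤ l` (copy of the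
private helper of `HubbardOneBodyKinematicRows` §6). [folklore] -/
private theorem neg_cos_le_cos_foldedCell {M l : ℕ} (hM : 0 < M) (hl : l < 2 * M) {x : ℝ}
    (hx1 : -π + l * π / M ≤ x) (hx2 : x ≤ -π + (l + 1) * π / M) :
    -Real.cos x ≤ Real.cos (((if l < M then l else 2 * M - 1 - l : ℕ) : ℝ) * π / M) := by
  have hMr : (0 : ℝ) < M := by exact_mod_cast hM
  have hπ := Real.pi_pos
  split_ifs with hlM
  · rw [← Real.cos_add_pi]
    have hl1 : ((l : ℝ) + 1) * π / M ≤ π := by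
      rw [div_le_iff₀ hMr]
      have h : (l : ℝ) + 1 ≤ M := by exact_mod_cast hlM
      nlinarith
    have hl0 : 0 ≤ (l : ℝ) * π / M := by positivity
    exact Real.cos_le_cos_of_nonneg_of_le_pi hl0 (by linarith) (by linarith)
  · rw [not_lt] at hlM
    rw [← Real.cos_pi_sub]
    have hcast : ((2 * M - 1 - l : ℕ) : ℝ) = 2 * M - 1 - l := by
      rw [Nat.cast_sub (by omega), Nat.cast_sub (by omega)]
      push_cast
      ring
    rw [hcast]
    have hMl : π ≤ (l : ℝ) * π / M := by
      rw [le_div_iff₀ hMr]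
      have h : (M : ℝ) ≤ l := by exact_mod_cast hlM
      nlinarith
    have h2Ml : 0 ≤ (2 * (M : ℝ) - 1 - l) * π / M := by
      have h : (l : ℝ) + 1 ≤ 2 * M := by exact_mod_cast (show l + 1 ≤ 2 * M by omega)
      apply div_nonneg (mul_nonneg (by linarith) hπ.le) hMr.le
    have heq : (2 * (M : ℝ) - 1 - l) * π / M = 2 * π - ((l : ℝ) + 1) * π / M := by
      field_simp
      ring
    refine Real.cos_le_cos_of_nonneg_of_le_pi h2Ml (by linarith) ?_
    rw [heq]
    linarith

/-- Lower end of the folded cell: on `-π + lπ/M ≤ x ≤ -π + (l+1)π/M` (`l < 2M`) the shifted cosine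
`-cos x` is at least `cos((c+1)π/M)`, `c` the folded cell index (copy of the private helper of
`HubbardOneBodyKinematicRows` §6b). [folklore] -/
private theorem cos_foldedCell_succ_le_neg_cos {M l : ℕ} (hM : 0 < M) (hl : l < 2 * M) {x : ℝ}
    (hx1 : -π + l * π / M ≤ x) (hx2 : x ≤ -π + (l + 1) * π / M) :
    Real.cos ((((if l < M then l else 2 * M - 1 - l : ℕ) : ℝ) + 1) * π / M) ≤ -Real.cos x := by
  have hMr : (0 : ℝ) < M := by exact_mod_cast hM
  have hπ := Real.pi_pos
  split_ifs with hlM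
  · rw [← Real.cos_add_pi]
    have hl1 : ((l : ℝ) + 1) * π / M ≤ π := by
      rw [div_le_iff₀ hMr]
      have h : (l : ℝ) + 1 ≤ M := by exact_mod_cast hlM
      nlinarith
    have hl0 : 0 ≤ (l : ℝ) * π / M := by positivity
    exact Real.cos_le_cos_of_nonneg_of_le_pi (by linarith) hl1 (by linarith)
  · rw [not_lt] at hlM
    rw [← Real.cos_pi_sub]
    have hcast : ((2 * M - 1 - l : ℕ) : ℝ) = 2 * M - 1 - l := by
      rw [Nat.cast_sub (by omega), Nat.cast_sub (by omega)]
      push_cast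
      ring
    rw [hcast]
    have h2Ml : 0 ≤ (2 * (M : ℝ) - 1 - l) * π / M := by
      have h : (l : ℝ) + 1 ≤ 2 * M := by exact_mod_cast (show l + 1 ≤ 2 * M by omega)
      apply div_nonneg (mul_nonneg (by linarith) hπ.le) hMr.le
    have heq : (2 * (M : ℝ) - 1 - l + 1) * π / M = 2 * π - (l : ℝ) * π / M := by
      field_simp
      ring
    have hle : (2 * (M : ℝ) - 1 - l + 1) * π / M ≤ π := by
      rw [heq]
      have hMl : π ≤ (l : ℝ) * π / M := by
        rw [le_div_iff₀ hMr]
        have h : (M : ℝ) ≤ l := by exact_mod_cast hlM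
        nlinarith
      linarith
    have heq' : (2 * (M : ℝ) - 1 - l) * π / M = 2 * π - ((l : ℝ) + 1) * π / M := by
      field_simp
      ring
    refine Real.cos_le_cos_of_nonneg_of_le_pi ?_ hle ?_
    · have : π - x ≥ (2 * (M : ℝ) - 1 - l) * π / M := by rw [heq']; linarith
      linarith
    · rw [heq]; linarith

/-- `∫_α^β (A + B cos y) dy = A(β - α) + B(sin β - sin α)`. [folklore] -/
private theorem integral_const_add_mul_cos (A B α β : ℝ) :
    ∫ y in α..β, (A + B * Real.cos y) = A * (β - α) + B * (Real.sin β - Real.sin α) := by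
  have h1 : IntervalIntegrable (fun _ : ℝ => A) MeasureTheory.volume α β := intervalIntegrable_const
  have h2 : IntervalIntegrable (fun y : ℝ => B * Real.cos y) MeasureTheory.volume α β :=
    (Real.continuous_cos.const_mul B).intervalIntegrable _ _
  rw [intervalIntegral.integral_add h1 h2, intervalIntegral.integral_const, intervalIntegral.integral_const_mul,
    integral_cos, smul_eq_mul]
  ring

/-- The band integrated over a rectangle in closed form (copy of KinematicRows §6b):
`∫_α^β ∫_γ^δ (2t(cos x + cos y) - 4t' cos x cos y - μ) dy dx
 = 2t(δ-γ)(sin β - sin α) + 2t(β-α)(sin δ - sin γ) - 4t'(sin β - sin α)(sin δ - sin γ) - μ(β-α)(δ-γ)`.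
[folklore] -/
private theorem cellIntegral_band (t t' μ α β γ δ : ℝ) :
    ∫ x in α..β, ∫ y in γ..δ,
        (2 * t * (Real.cos x + Real.cos y) - 4 * t' * (Real.cos x * Real.cos y) - μ) =
      2 * t * (δ - γ) * (Real.sin β - Real.sin α) + 2 * t * (β - α) * (Real.sin δ - Real.sin γ) -
        4 * t' * ((Real.sin β - Real.sin α) * (Real.sin δ - Real.sin γ)) - μ * ((β - α) * (δ - γ)) := by
  have inner : (fun x => ∫ y in γ..δ,
      (2 * t * (Real.cos x + Real.cos y) - 4 * t' * (Real.cos x * Real.cos y) - μ)) =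
      fun x => (-(μ * (δ - γ)) + 2 * t * (Real.sin δ - Real.sin γ)) +
        (2 * t * (δ - γ) - 4 * t' * (Real.sin δ - Real.sin γ)) * Real.cos x := by
    funext x
    have h := integral_const_add_mul_cos (2 * t * Real.cos x - μ) (2 * t - 4 * t' * Real.cos x) γ δ
    have hc : (∫ y in γ..δ, (2 * t * (Real.cos x + Real.cos y) - 4 * t' * (Real.cos x * Real.cos y) - μ)) =
        ∫ y in γ..δ, (2 * t * Real.cos x - μ + (2 * t - 4 * t' * Real.cos x) * Real.cos y) :=
      intervalIntegral.integral_congr fun y _ => by ring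
    rw [hc, h]
    ring
  rw [inner, integral_const_add_mul_cos]
  ring

/-- The sine increments of the two pre-images of a folded cell agree up to sign with the folded one
(copy of KinematicRows §6b). [folklore] -/
private theorem sin_sub_sin_foldedCell {M l : ℕ} (hM : 0 < M) (hl : l < 2 * M) :
    Real.sin (-π + ((l : ℝ) + 1) * π / M) - Real.sin (-π + (l : ℝ) * π / M) =
      -(Real.sin ((((if l < M then l else 2 * M - 1 - l : ℕ) : ℝ) + 1) * π / M) -
        Real.sin (((if l < M then l else 2 * M - 1 - l : ℕ) : ℝ) * π / M)) := by
  have hMr : (0 : ℝ) < M := by exact_mod_cast hM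
  split_ifs with hlM
  · rw [show -π + ((l : ℝ) + 1) * π / M = ((l : ℝ) + 1) * π / M - π by ring,
      show -π + (l : ℝ) * π / M = (l : ℝ) * π / M - π by ring, Real.sin_sub_pi, Real.sin_sub_pi]
    ring
  · rw [not_lt] at hlM
    have hcast : ((2 * M - 1 - l : ℕ) : ℝ) = 2 * M - 1 - l := by
      rw [Nat.cast_sub (by omega), Nat.cast_sub (by omega)]
      push_cast
      ring
    rw [hcast,
      show -π + ((l : ℝ) + 1) * π / M = π - (2 * (M : ℝ) - 1 - l) * π / M by field_simp; ring,
      show -π + (l : ℝ) * π / M = π - (2 * (M : ℝ) - 1 - l + 1) * π / M by field_simp; ring,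
      Real.sin_pi_sub, Real.sin_pi_sub]
    ring

/-- **Cell sums under the double integral** (copy of KinematicRows §6b): lower bounds `B l₁ l₂` of the
CELL INTEGRALS of a continuous `g` over the `2M × 2M` uniform cells of `[-π, π]²` add up to a lower bound
of `∫_{-π}^{π}∫_{-π}^{π} g`. [folklore] -/
private theorem cellSum_le_integral_square {g : ℝ → ℝ → ℝ} (hg : Continuous (Function.uncurry g))
    {M : ℕ} (hM : 0 < M) (B : ℕ → ℕ → ℝ)
    (hB : ∀ l₁, l₁ < 2 * M → ∀ l₂, l₂ < 2 * M →
      B l₁ l₂ ≤ ∫ x in (-π + l₁ * π / M)..(-π + (l₁ + 1) * π / M),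
        ∫ y in (-π + l₂ * π / M)..(-π + (l₂ + 1) * π / M), g x y) :
    ∑ l₁ ∈ Finset.range (2 * M), ∑ l₂ ∈ Finset.range (2 * M), B l₁ l₂ ≤
      ∫ x in (-π)..π, ∫ y in (-π)..π, g x y := by
  have hMr : (0 : ℝ) < M := by exact_mod_cast hM
  have hπ := Real.pi_pos
  set a : ℕ → ℝ := fun l => -π + l * π / M with ha
  have ha0 : a 0 = -π := by simp [ha]
  have ha2M : a (2 * M) = π := by
    simp only [ha]
    push_cast
    field_simp
    ring
  have haS : ∀ l : ℕ, a (l + 1) = -π + ((l : ℝ) + 1) * π / M := fun l => by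
    simp only [ha, Nat.cast_add_one]
  have hgx : ∀ x, Continuous (g x) := fun x => hg.uncurry_left x
  have hFl : ∀ l₂ : ℕ, Continuous fun x => ∫ y in (a l₂)..(a (l₂ + 1)), g x y := fun l₂ =>
    intervalIntegral.continuous_parametric_intervalIntegral_of_continuous' hg _ _
  have hF : Continuous fun x => ∫ y in (-π)..π, g x y :=
    intervalIntegral.continuous_parametric_intervalIntegral_of_continuous' hg (-π) π
  have hinner : ∀ x, ∫ y in (-π)..π, g x y = ∑ l₂ ∈ Finset.range (2 * M), ∫ y in (a l₂)..(a (l₂ + 1)), g x y := by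
    intro x
    rw [intervalIntegral.sum_integral_adjacent_intervals fun k _ => (hgx x).intervalIntegrable _ _, ha0, ha2M]
  have hsplit : ∫ x in (-π)..π, ∫ y in (-π)..π, g x y =
      ∑ l₁ ∈ Finset.range (2 * M), ∫ x in (a l₁)..(a (l₁ + 1)), ∫ y in (-π)..π, g x y := by
    rw [intervalIntegral.sum_integral_adjacent_intervals fun k _ => hF.intervalIntegrable _ _, ha0, ha2M]
  rw [hsplit]
  refine Finset.sum_le_sum fun l₁ hl₁ => ?_
  rw [Finset.mem_range] at hl₁
  have hswap : ∫ x in (a l₁)..(a (l₁ + 1)), ∫ y in (-π)..π, g x y =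
      ∑ l₂ ∈ Finset.range (2 * M), ∫ x in (a l₁)..(a (l₁ + 1)), ∫ y in (a l₂)..(a (l₂ + 1)), g x y := by
    rw [← intervalIntegral.integral_finsetSum fun l₂ _ => (hFl l₂).intervalIntegrable _ _]
    exact intervalIntegral.integral_congr fun x _ => hinner x
  rw [hswap]
  refine Finset.sum_le_sum fun l₂ hl₂ => ?_
  rw [Finset.mem_range] at hl₂
  have h := hB l₁ hl₁ l₂ hl₂
  rw [← haS l₁, ← haS l₂] at h
  exact h

/-- A pointwise constant lower bound on a cell integrates to `Δ² c` (copy of KinematicRows §6b). [folklore] -/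
private theorem sq_mul_le_cellIntegral {g : ℝ → ℝ → ℝ} (hg : Continuous (Function.uncurry g))
    {α β γ δ c : ℝ} (hαβ : α ≤ β) (hγδ : γ ≤ δ)
    (h : ∀ x ∈ Icc α β, ∀ y ∈ Icc γ δ, c ≤ g x y) :
    (β - α) * (δ - γ) * c ≤ ∫ x in α..β, ∫ y in γ..δ, g x y := by
  have hgx : ∀ x, Continuous (g x) := fun x => hg.uncurry_left x
  have hF : Continuous fun x => ∫ y in γ..δ, g x y :=
    intervalIntegral.continuous_parametric_intervalIntegral_of_continuous' hg _ _
  have hin : ∀ x ∈ Icc α β, (δ - γ) * c ≤ ∫ y in γ..δ, g x y := by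
    intro x hx
    calc (δ - γ) * c = ∫ _ in γ..δ, c := by rw [intervalIntegral.integral_const, smul_eq_mul]
      _ ≤ ∫ y in γ..δ, g x y :=
          intervalIntegral.integral_mono_on hγδ intervalIntegrable_const ((hgx x).intervalIntegrable _ _)
            fun y hy => h x hx y hy
  calc (β - α) * (δ - γ) * c = ∫ _ in α..β, (δ - γ) * c := by
        rw [intervalIntegral.integral_const, smul_eq_mul]; ring
    _ ≤ ∫ x in α..β, ∫ y in γ..δ, g x y :=
        intervalIntegral.integral_mono_on hαβ intervalIntegrable_const (hF.intervalIntegrable _ _) hin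

/-- Folding the `2M` cells of `[-π, π]` onto the `M` cells of `[0, π]`: every index `i < M` is the folded
cell index of exactly two cells (copy of KinematicRows §6). [folklore] -/
private theorem sum_range_two_mul_foldedCell {β : Type*} [AddCommMonoid β] (M : ℕ) (f : ℕ → β) :
    ∑ l ∈ Finset.range (2 * M), f (if l < M then l else 2 * M - 1 - l) =
      ∑ i ∈ Finset.range M, f i + ∑ i ∈ Finset.range M, f i := by
  rw [two_mul, Finset.sum_range_add]
  congr 1
  · exact Finset.sum_congr rfl fun l hl => by
      rw [Finset.mem_range] at hl
      rw [if_pos hl]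
  · rw [← Finset.sum_range_reflect f M]
    exact Finset.sum_congr rfl fun l hl => by
      rw [Finset.mem_range] at hl
      rw [if_neg (by omega)]
      congr 1
      omega

/-- The Brillouin zone of `ℤ²` is the preimage of the square under `p ↦ (p 0, p 1)` (copy of the private
helper of `HubbardSquareFreeFermionEnergyDensity` §4). [folklore] -/
private theorem brillouin_two_eq_preimage_square'' :
    brillouin 2 = (MeasurableEquiv.finTwoArrow : (Fin 2 → ℝ) ≃ᵐ ℝ × ℝ) ⁻¹'
      (Icc (-π) π ×ˢ Icc (-π) π) := by
  ext p
  simp only [brillouin, Set.mem_pi, Set.mem_univ, true_implies, Set.mem_preimage, Set.mem_prod]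
  exact ⟨fun h => ⟨h 0, h 1⟩, fun h i => by fin_cases i <;> [exact h.1; exact h.2]⟩

/-- A Brillouin-zone integral over `[-π,π]²` as an integral over the square in `ℝ × ℝ` (copy of the private
helper of `HubbardSquareFreeFermionEnergyDensity` §4). [folklore] -/
private theorem integral_brillouin_two_eq_integral_square'' (g : ℝ × ℝ → ℝ) :
    ∫ p in brillouin 2, g (p 0, p 1) = ∫ q in Icc (-π) π ×ˢ Icc (-π) π, g q := by
  have h := (volume_preserving_finTwoArrow ℝ).setIntegral_preimage_emb
    (MeasurableEquiv.finTwoArrow : (Fin 2 → ℝ) ≃ᵐ ℝ × ℝ).measurableEmbedding g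
    (Icc (-π) π ×ˢ Icc (-π) π)
  rw [← brillouin_two_eq_preimage_square''] at h
  exact h

/-- Fubini on the square for a continuous integrand, with interval integrals (copy of the private helper
of `HubbardSquareFreeFermionEnergyDensity` §4). [folklore] -/
private theorem integral_square_eq_iterated'' {g : ℝ × ℝ → ℝ} (hg : Continuous g) :
    ∫ q in Icc (-π) π ×ˢ Icc (-π) π, g q = ∫ x in (-π)..π, ∫ y in (-π)..π, g (x, y) := by
  have hππ : -π ≤ π := by linarith [Real.pi_pos]
  rw [Measure.volume_eq_prod, setIntegral_prod g
      (hg.continuousOn.integrableOn_compact (isCompact_Icc.prod isCompact_Icc)),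
    intervalIntegral.integral_of_le hππ, ← integral_Icc_eq_integral_Ioc]
  refine setIntegral_congr_fun measurableSet_Icc fun x _ => ?_
  rw [intervalIntegral.integral_of_le hππ, ← integral_Icc_eq_integral_Ioc]

/-! ### §3 The cell-exact Fermi-sea bound for every `t, t'` -/

/-- **Cell-exact Fermi-sea bound, every `t, t'` (four-corner form).** Let `U ≥ 0`, `0 ≤ n < 2`, `M ≥ 1`;
let `uᵢ ≥ cos(iπ/M)` and `wᵢ ≤ cos((i+1)π/M)` (`i < M`) be any tables, `μ` any chemical potential, and let
`ins i j` flag cells CERTIFIED INTERIOR through the four corners: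
`ins i j = true → max(E(wᵢ,wⱼ), E(wᵢ,uⱼ), E(uᵢ,wⱼ), E(uᵢ,uⱼ)) ≤ μ`, `E(a,b) = -2t(a+b) - 4t'ab`
(bilinear, so `E ≤ μ` on the whole cell `[wᵢ,uᵢ] × [wⱼ,uⱼ] ∋ (-cos p₁, -cos p₂)`). Then, with
`Sᵢ = sin((i+1)π/M) - sin(iπ/M)` and `Δ = π/M`,

  `μ n + (2/π²) Σ_{i,j<M} cᵢⱼ ≤ e(t, t', U, n)`,
  `cᵢⱼ = -2tΔ(Sᵢ + Sⱼ) - 4t' SᵢSⱼ - μΔ²` if `ins i j`, else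
  `Δ² · min(min(E(wᵢ,wⱼ), E(wᵢ,uⱼ), E(uᵢ,wⱼ), E(uᵢ,uⱼ)) - μ, 0)`:

on a flagged cell the integrand `min(E - μ, 0)` of `energyDensityTT'_ge_bathtub` equals `E - μ` and is
integrated in closed form, elsewhere the least corner value bounds it below. No hypothesis relates `t'` to `t`;
for `2|t'| ≤ t` the max is `E(wᵢ,wⱼ)` and the min is `E(uᵢ,uⱼ)` and this is
`energyDensityTT'_ge_fermiSea_cellSum`. [cite: LiebLoss1993, §8, Theorem 8.2] -/
theorem energyDensityTT'_ge_fermiSea_cellSum₄ (t t' : ℝ) {U : ℝ} (hU : 0 ≤ U)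
    {n : ℝ} (hn0 : 0 ≤ n) (hn2 : n < 2) {M : ℕ} (hM : 0 < M) (u w : ℕ → ℝ)
    (hu : ∀ i < M, Real.cos (i * π / M) ≤ u i)
    (hw : ∀ i < M, w i ≤ Real.cos (((i : ℝ) + 1) * π / M))
    (μ : ℝ) (ins : ℕ → ℕ → Bool)
    (hins : ∀ i < M, ∀ j < M, ins i j = true →
      max (max (-(2 * t) * (w i + w j) - 4 * t' * (w i * w j)) (-(2 * t) * (w i + u j) - 4 * t' * (w i * u j)))
        (max (-(2 * t) * (u i + w j) - 4 * t' * (u i * w j)) (-(2 * t) * (u i + u j) - 4 * t' * (u i * u j))) ≤ μ) :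
    μ * n + 2 / π ^ 2 * ∑ i ∈ Finset.range M, ∑ j ∈ Finset.range M,
        (if ins i j then
          -(2 * t) * (π / M) * ((Real.sin (((i : ℝ) + 1) * π / M) - Real.sin (i * π / M)) +
              (Real.sin (((j : ℝ) + 1) * π / M) - Real.sin (j * π / M))) -
            4 * t' * ((Real.sin (((i : ℝ) + 1) * π / M) - Real.sin (i * π / M)) *
              (Real.sin (((j : ℝ) + 1) * π / M) - Real.sin (j * π / M))) -
            μ * (π / M) ^ 2
        else (π / M) ^ 2 * min (min (min (-(2 * t) * (w i + w j) - 4 * t' * (w i * w j))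
            (-(2 * t) * (w i + u j) - 4 * t' * (w i * u j)))
          (min (-(2 * t) * (u i + w j) - 4 * t' * (u i * w j)) (-(2 * t) * (u i + u j) - 4 * t' * (u i * u j))) -
            μ) 0) ≤
      energyDensityTT' t t' U n := by
  have hMr : (0 : ℝ) < M := by exact_mod_cast hM
  have hπ := Real.pi_pos
  have hΔ : 0 < π / M := by positivity
  -- folded index and the cell value as a function of the folded indices
  set c : ℕ → ℕ := fun l => if l < M then l else 2 * M - 1 - l with hcdef
  have hcM : ∀ l, l < 2 * M → c l < M := by
    intro l hl
    simp only [hcdef]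
    split_ifs <;> omega
  set S : ℕ → ℝ := fun i => Real.sin (((i : ℝ) + 1) * π / M) - Real.sin (i * π / M) with hSdef
  -- the four-corner minimum
  set m₄ : ℕ → ℕ → ℝ := fun i j => min (min (-(2 * t) * (w i + w j) - 4 * t' * (w i * w j))
      (-(2 * t) * (w i + u j) - 4 * t' * (w i * u j)))
    (min (-(2 * t) * (u i + w j) - 4 * t' * (u i * w j)) (-(2 * t) * (u i + u j) - 4 * t' * (u i * u j)))
    with hm₄def
  set C : ℕ → ℕ → ℝ := fun i j =>
    if ins i j then -(2 * t) * (π / M) * (S i + S j) - 4 * t' * (S i * S j) - μ * (π / M) ^ 2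
    else (π / M) ^ 2 * min (m₄ i j - μ) 0 with hCdef
  -- the integrand
  set G : ℝ → ℝ → ℝ := fun x y =>
    min (2 * t * (Real.cos x + Real.cos y) - 4 * t' * (Real.cos x * Real.cos y) - μ) 0 with hGdef
  have hgc : Continuous (Function.uncurry G) := by
    rw [hGdef, Function.uncurry_def]
    fun_prop
  -- on the cell `(l₁, l₂)`: `w (c l₁) ≤ -cos x ≤ u (c l₁)`, `w (c l₂) ≤ -cos y ≤ u (c l₂)`
  have hrange : ∀ l, l < 2 * M → ∀ x ∈ Icc (-π + (l : ℝ) * π / M) (-π + ((l : ℝ) + 1) * π / M),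
      w (c l) ≤ -Real.cos x ∧ -Real.cos x ≤ u (c l) := by
    intro l hl x hx
    exact ⟨(hw _ (hcM l hl)).trans (cos_foldedCell_succ_le_neg_cos hM hl hx.1 hx.2),
      (neg_cos_le_cos_foldedCell hM hl hx.1 hx.2).trans (hu _ (hcM l hl))⟩
  -- the cell bound
  have hcell : ∀ l₁, l₁ < 2 * M → ∀ l₂, l₂ < 2 * M →
      C (c l₁) (c l₂) ≤ ∫ x in (-π + l₁ * π / M)..(-π + (l₁ + 1) * π / M),
        ∫ y in (-π + l₂ * π / M)..(-π + (l₂ + 1) * π / M), G x y := by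
    intro l₁ hl₁ l₂ hl₂
    have hα : -π + (l₁ : ℝ) * π / M ≤ -π + ((l₁ : ℝ) + 1) * π / M := by
      have : (l₁ : ℝ) * π / M ≤ ((l₁ : ℝ) + 1) * π / M := by gcongr; linarith
      linarith
    have hγ : -π + (l₂ : ℝ) * π / M ≤ -π + ((l₂ : ℝ) + 1) * π / M := by
      have : (l₂ : ℝ) * π / M ≤ ((l₂ : ℝ) + 1) * π / M := by gcongr; linarith
      linarith
    -- the corner bounds on this cell
    have hcorner : ∀ x ∈ Icc (-π + (l₁ : ℝ) * π / M) (-π + ((l₁ : ℝ) + 1) * π / M),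
        ∀ y ∈ Icc (-π + (l₂ : ℝ) * π / M) (-π + ((l₂ : ℝ) + 1) * π / M),
        m₄ (c l₁) (c l₂) ≤ 2 * t * (Real.cos x + Real.cos y) - 4 * t' * (Real.cos x * Real.cos y) ∧
        2 * t * (Real.cos x + Real.cos y) - 4 * t' * (Real.cos x * Real.cos y) ≤
          max (max (-(2 * t) * (w (c l₁) + w (c l₂)) - 4 * t' * (w (c l₁) * w (c l₂)))
              (-(2 * t) * (w (c l₁) + u (c l₂)) - 4 * t' * (w (c l₁) * u (c l₂))))
            (max (-(2 * t) * (u (c l₁) + w (c l₂)) - 4 * t' * (u (c l₁) * w (c l₂)))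
              (-(2 * t) * (u (c l₁) + u (c l₂)) - 4 * t' * (u (c l₁) * u (c l₂)))) := by
      intro x hx y hy
      obtain ⟨hA, ha⟩ := hrange l₁ hl₁ x hx
      obtain ⟨hB, hb⟩ := hrange l₂ hl₂ y hy
      have key := shiftedBand_corner_bounds t t' hA ha hB hb
      have hE : -(2 * t) * (-Real.cos x + -Real.cos y) - 4 * t' * (-Real.cos x * -Real.cos y) =
          2 * t * (Real.cos x + Real.cos y) - 4 * t' * (Real.cos x * Real.cos y) := by ring
      rw [hE] at key
      simpa only [hm₄def] using key
    simp only [hCdef]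
    by_cases hin : ins (c l₁) (c l₂) = true
    · -- interior cell: `G = E - μ` on the cell, integrate exactly
      rw [if_pos hin]
      have hEμ : ∀ x ∈ Icc (-π + (l₁ : ℝ) * π / M) (-π + ((l₁ : ℝ) + 1) * π / M),
          ∀ y ∈ Icc (-π + (l₂ : ℝ) * π / M) (-π + ((l₂ : ℝ) + 1) * π / M),
          2 * t * (Real.cos x + Real.cos y) - 4 * t' * (Real.cos x * Real.cos y) - μ ≤ 0 := by
        intro x hx y hy
        have h := (hcorner x hx y hy).2
        linarith [hins _ (hcM l₁ hl₁) _ (hcM l₂ hl₂) hin]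
      have hGE : ∫ x in (-π + (l₁ : ℝ) * π / M)..(-π + ((l₁ : ℝ) + 1) * π / M),
          ∫ y in (-π + (l₂ : ℝ) * π / M)..(-π + ((l₂ : ℝ) + 1) * π / M), G x y =
          ∫ x in (-π + (l₁ : ℝ) * π / M)..(-π + ((l₁ : ℝ) + 1) * π / M),
          ∫ y in (-π + (l₂ : ℝ) * π / M)..(-π + ((l₂ : ℝ) + 1) * π / M),
            (2 * t * (Real.cos x + Real.cos y) - 4 * t' * (Real.cos x * Real.cos y) - μ) := by
        refine intervalIntegral.integral_congr fun x hx => ?_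
        rw [uIcc_of_le hα] at hx
        refine intervalIntegral.integral_congr fun y hy => ?_
        rw [uIcc_of_le hγ] at hy
        simp only [hGdef]
        exact min_eq_left (hEμ x hx y hy)
      rw [hGE, cellIntegral_band, sin_sub_sin_foldedCell hM hl₁, sin_sub_sin_foldedCell hM hl₂]
      simp only [hSdef, hcdef]
      have hΔ₁ : -π + ((l₁ : ℝ) + 1) * π / M - (-π + (l₁ : ℝ) * π / M) = π / M := by
        field_simp; ring
      have hΔ₂ : -π + ((l₂ : ℝ) + 1) * π / M - (-π + (l₂ : ℝ) * π / M) = π / M := by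
        field_simp; ring
      rw [hΔ₁, hΔ₂]
      apply le_of_eq
      ring
    · -- other cell: the least corner value, integrated
      rw [if_neg hin]
      have hpt : ∀ x ∈ Icc (-π + (l₁ : ℝ) * π / M) (-π + ((l₁ : ℝ) + 1) * π / M),
          ∀ y ∈ Icc (-π + (l₂ : ℝ) * π / M) (-π + ((l₂ : ℝ) + 1) * π / M),
          min (m₄ (c l₁) (c l₂) - μ) 0 ≤ G x y := by
        intro x hx y hy
        have h := (hcorner x hx y hy).1
        simp only [hGdef]
        exact min_le_min_right 0 (by linarith)
      have h := sq_mul_le_cellIntegral hgc hα hγ hpt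
      have hΔ₁ : -π + ((l₁ : ℝ) + 1) * π / M - (-π + (l₁ : ℝ) * π / M) = π / M := by
        field_simp; ring
      have hΔ₂ : -π + ((l₂ : ℝ) + 1) * π / M - (-π + (l₂ : ℝ) * π / M) = π / M := by
        field_simp; ring
      rw [hΔ₁, hΔ₂, ← sq] at h
      exact h
  have hgrid := cellSum_le_integral_square hgc hM (fun l₁ l₂ => C (c l₁) (c l₂)) hcell
  -- fold the `2M × 2M` sum onto the `M × M` sum
  have hS : ∑ l₁ ∈ Finset.range (2 * M), ∑ l₂ ∈ Finset.range (2 * M), C (c l₁) (c l₂) =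
      4 * ∑ i ∈ Finset.range M, ∑ j ∈ Finset.range M, C i j := by
    have h1 : ∀ l₁ : ℕ, ∑ l₂ ∈ Finset.range (2 * M), C (c l₁) (c l₂) =
        2 * ∑ j ∈ Finset.range M, C (c l₁) j := by
      intro l₁
      have h := sum_range_two_mul_foldedCell M fun j => C (c l₁) j
      simp only [hcdef] at h ⊢
      rw [h]
      ring
    rw [Finset.sum_congr rfl fun l₁ _ => h1 l₁, ← Finset.mul_sum]
    have h2 := sum_range_two_mul_foldedCell M fun i => ∑ j ∈ Finset.range M, C i j
    simp only [hcdef] at h2 ⊢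
    rw [h2]
    ring
  -- the bathtub bound as the iterated integral over the square
  have hbath := energyDensityTT'_ge_bathtub t t' hU hn0 hn2 μ
  have hsq : (∫ p in brillouin 2, min (2 * t * (Real.cos (p 0) + Real.cos (p 1)) -
      4 * t' * (Real.cos (p 0) * Real.cos (p 1)) - μ) 0) = ∫ x in (-π)..π, ∫ y in (-π)..π, G x y := by
    have h := integral_brillouin_two_eq_integral_square''
      (fun q : ℝ × ℝ => min (2 * t * (Real.cos q.1 + Real.cos q.2) -
        4 * t' * (Real.cos q.1 * Real.cos q.2) - μ) 0)
    dsimp only at h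
    rw [h, integral_square_eq_iterated'' (by fun_prop)]
  rw [hsq] at hbath
  rw [hS] at hgrid
  -- the statement's sum is `Σ C i j`
  have hsum : ∑ i ∈ Finset.range M, ∑ j ∈ Finset.range M,
      (if ins i j then
          -(2 * t) * (π / M) * ((Real.sin (((i : ℝ) + 1) * π / M) - Real.sin (i * π / M)) +
              (Real.sin (((j : ℝ) + 1) * π / M) - Real.sin (j * π / M))) -
            4 * t' * ((Real.sin (((i : ℝ) + 1) * π / M) - Real.sin (i * π / M)) *
              (Real.sin (((j : ℝ) + 1) * π / M) - Real.sin (j * π / M))) -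
            μ * (π / M) ^ 2
        else (π / M) ^ 2 * min (min (min (-(2 * t) * (w i + w j) - 4 * t' * (w i * w j))
            (-(2 * t) * (w i + u j) - 4 * t' * (w i * u j)))
          (min (-(2 * t) * (u i + w j) - 4 * t' * (u i * w j)) (-(2 * t) * (u i + u j) - 4 * t' * (u i * u j))) -
            μ) 0) =
      ∑ i ∈ Finset.range M, ∑ j ∈ Finset.range M, C i j := by
    simp only [hCdef, hSdef, hm₄def]
  rw [hsum]
  set T := ∑ i ∈ Finset.range M, ∑ j ∈ Finset.range M, C i j with hTdef
  calc μ * n + 2 / π ^ 2 * T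
        = μ * n + 2 * (((2 * Real.pi) ^ 2)⁻¹ * (4 * T)) := by
          field_simp
          ring
    _ ≤ μ * n + 2 * (((2 * Real.pi) ^ 2)⁻¹ * ∫ x in (-π)..π, ∫ y in (-π)..π, G x y) := by
          gcongr
    _ ≤ energyDensityTT' t t' U n := hbath

/-- **The `t = 1` form for every `t'`** (no `|t'| ≤ 1/2`); see `energyDensityTT'_ge_fermiSea_cellSum₄`. This is
the input of the rational adapter `energyDensityTT'_one_ge_affine_cellTable64_anyTPrime` of
`HubbardFermiSeaCellRows`. [cite: LiebLoss1993, §8, Theorem 8.2] -/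
theorem energyDensityTT'_one_ge_fermiSea_cellSum₄ (t' : ℝ) {U : ℝ} (hU : 0 ≤ U)
    {n : ℝ} (hn0 : 0 ≤ n) (hn2 : n < 2) {M : ℕ} (hM : 0 < M) (u w : ℕ → ℝ)
    (hu : ∀ i < M, Real.cos (i * π / M) ≤ u i)
    (hw : ∀ i < M, w i ≤ Real.cos (((i : ℝ) + 1) * π / M))
    (μ : ℝ) (ins : ℕ → ℕ → Bool)
    (hins : ∀ i < M, ∀ j < M, ins i j = true →
      max (max (-2 * (w i + w j) - 4 * t' * (w i * w j)) (-2 * (w i + u j) - 4 * t' * (w i * u j)))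
        (max (-2 * (u i + w j) - 4 * t' * (u i * w j)) (-2 * (u i + u j) - 4 * t' * (u i * u j))) ≤ μ) :
    μ * n + 2 / π ^ 2 * ∑ i ∈ Finset.range M, ∑ j ∈ Finset.range M,
        (if ins i j then
          -2 * (π / M) * ((Real.sin (((i : ℝ) + 1) * π / M) - Real.sin (i * π / M)) +
              (Real.sin (((j : ℝ) + 1) * π / M) - Real.sin (j * π / M))) -
            4 * t' * ((Real.sin (((i : ℝ) + 1) * π / M) - Real.sin (i * π / M)) *
              (Real.sin (((j : ℝ) + 1) * π / M) - Real.sin (j * π / M))) -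
            μ * (π / M) ^ 2
        else (π / M) ^ 2 * min (min (min (-2 * (w i + w j) - 4 * t' * (w i * w j))
            (-2 * (w i + u j) - 4 * t' * (w i * u j)))
          (min (-2 * (u i + w j) - 4 * t' * (u i * w j)) (-2 * (u i + u j) - 4 * t' * (u i * u j))) - μ) 0) ≤
      energyDensityTT' 1 t' U n := by
  have h := energyDensityTT'_ge_fermiSea_cellSum₄ 1 t' hU hn0 hn2 hM u w hu hw μ ins
    (fun i hi j hj hij => by have := hins i hi j hj hij; simpa only [mul_one] using this)
  simpa only [mul_one] using h

end FermiSeaCellSumAnyTPrime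

end Literature.MathematicalPhysics.QuantumLattice
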